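import Summits.HubbardSuperconductivity.HubbardSuperconductivity.Theorems.KLProgrammeKLRegimeScaleZeroMidShellResolventJet
import Summits.HubbardSuperconductivity.HubbardSuperconductivity.Theorems.KLProgrammeKLRegimeScaleZeroCovarianceFarL2Images
import Summits.HubbardSuperconductivity.HubbardSuperconductivity.Theorems.KLProgrammeKLRegimeFlowReadScaleZeroSunsetFarGapCertDefs

/-!
# Route `KLProgramme`, crux K3 — engine-flow child (stmt-HubbardSuperconductivity-20437), stub (C) at `n = 0`, located item #22a «(C)-SCALE0-PT2»:
# THE MID-SHELL FAR GAP, KIT-FREE — part 2: the symbol on the shell `klE0 ≤ |ω|` is the pure resolvent, its fourth lattice-line derivatives are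
# `≤ π⁴·P(|ω|)`, and the two Parseval gaps beyond `‖z‖∞ > Rc` are `≤ P²/(128·Rc⁸)`, `≤ P²/(64·Rc⁶)`; at `Rc = 1024` the outer-shell certificate of the
# two-low-shell one-call holds for any rational records above `P(ω₀)²/(128·Rc⁸)`, `P(ω₀)²/(64·Rc⁶)` (`1/1024`, `640` at Rc = 1024) — A THEOREM, NOT A KIT RECORD

Seat hubbard-kl-k3c5-p1 (g18; owner of #22a).  Companion of `…ScaleZeroMidShellResolventJet` (the 1-D jet, the line lemma, the Parseval bound).  For the
bare-frame scale-0 spatial symbol `Ψ_{μ,ω}(y) = uvSymbolFn 1 klE0 (e₀(2πy) − μ) ω`: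
* §1 `uvWeightFn_eq_one_of_klE0_le`, `uvSymbolFn_eq_inv_of_klE0_le` — on `klE0 ≤ |ω|` the weight is `1` and `Ψ = 1/(−iω + e)`; `frameLevel_line_apply`,
  `uvSymbol_line_eq_res0` — along `y + t·e_j` the symbol is `R₀(K_j(y), y_j + t)` with `K_j(y) = −iω + (−2cos(2πy_{1−j}) − μ)`, `Im K_j = −ω`;
* §2 `norm_dirIter_four_uvSymbol_le`, `norm_partialDeriv_four_descend_uvSymbol_le` — `‖(∂_{e_j})⁴Ψ‖, ‖∂ⱼ⁴(Ψ♭)‖ ≤ π⁴·P(|ω|)`,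
  `P(m) = 6144/m⁵ + 4608/m⁴ + 896/m³ + 32/m²`;
* §3 `far_weight_le`, `sq_le_of_not_mem_insert_disk` — outside `{0} ∪ disk(Rc)`: `z₀² + z₁² ≤ (2/Rc⁶)(z₀⁸ + z₁⁸)` and `1 ≤ (z₀⁸ + z₁⁸)/Rc⁸`;
* §4 **`midShell_farGap_le`** — for `klE0 ≤ |ω|`, every `μ`, every near box with `0 < Rc`: the cert's `gap₀ ≤ P(|ω|)²/(128·Rc⁸)` and `gap₂ ≤ P(|ω|)²/(64·Rc⁶)`
  (Parseval for `∂ⱼ⁴Ψ♭`: `Σ_k k_j⁸‖a(k)‖² ≤ P²/256`; the gaps are the far lattice sums by `tsum_far_eq_total_sub_near` + the `k ≤ 2` Parseval identities of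
  `…CovarianceFarL2Images`; the `π⁸` of the jet cancels the `(2π)⁸` of Parseval, so every bound is RATIONAL in `|ω|` and `Rc`);
* §5 **`midShell_farGapCertOn_of_rat`** — in exactly the shape of the outer-shell hypothesis `hrmid` of `…SunsetCertRowsThreeShellsRecords.sunsetRows_of_records3_farSup`,
  for any split radius `Rc > 0`, any crossover `ω₀ = rlo.ω₁ ≥ 1/32` and any outer record `rmid` with `P(ω₀)²/(128·Rc⁸) ≤ rmid.G₀`, `P(ω₀)²/(64·Rc⁶) ≤ rmid.G₂`
  (two closed rational inequalities, `norm_num` on literals), uniformly in `μ`; at `Rc = 1024`, `ω₀ = 1/32`: `P = 211019661312`, `P²/(64·1024⁶) = 603.5`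
  (so `G₂ = 640` passes), `P²/(128·1024⁸) = 2.9·10⁻⁴` (so `G₀ = 1/1024` passes).
CONSEQUENCE FOR #22a (two-low-shell format, (R361)(1)): the OUTER shell `[1/32, ω₁)` of KIT JOB B′ needs no computation — far row₂ share `(Sfar + 10⁻²⁹)·ω₁·(√640 + 10⁻¹⁰)²
≈ 5.7·10⁻³` at `Sfar = 3.535·10⁻⁵`, `ω₁ = 1/4`; only the inner shell `(0, 1/32)` (where the weight χ₂ is active, see the g18 no-go numbers on the bus) remains a certified-numerics
record.  Everything proved; no certificate, no stub of 20437, (C), K3, the margin or superconductivity is asserted.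
References: BGM 2006 §2.3 (2.17)–(2.20), §3 (3.2) [cite: BenfattoGiulianiMastropietro2006]; Grafakos 2014 Prop. 3.2.6 (8), 3.2.7 (3) [cite: Grafakos2014].
-/

noncomputable section

namespace Summit.HubbardSuperconductivity.HubbardSuperconductivity.Theorems.KLRegimeSplit

set_option linter.dupNamespace false -- summit = problem name (single-conjunct summit), D-0017

open Literature.MathematicalPhysics.QuantumLattice Literature.Probability.LatticeModels Literature.Analysis.FunctionSpaces
open Literature.Analysis.Fourier Literature.Algebra.EuclideanLattices
open Summit.HubbardSuperconductivity.HubbardSuperconductivity.Theorems.DispersionFlow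
open MeasureTheory Finset Complex UnitAddTorus Real

/-! ## §1 On the shell `klE0 ≤ |ω|` the spatial symbol is the pure resolvent; its restriction to a lattice line -/

/-- `klE0 ≤ |ω|` forces the ultraviolet weight to `1`: `W(e, ω) = χ₂((ω²+e²)/klE0²) = 1`. [cite: BenfattoGiulianiMastropietro2006, §2.3] -/
theorem uvWeightFn_eq_one_of_klE0_le {om : ℝ} (hom : klE0 ≤ |om|) (e : ℝ) : uvWeightFn klE0 e om = 1 := by
  have hE0 : (0 : ℝ) < klE0 := by norm_num [klE0]
  unfold uvWeightFn
  refine salmhoferCutoff_of_ge ?_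
  rw [le_div_iff₀ (by positivity), one_mul]
  have h1 : klE0 ^ 2 ≤ om ^ 2 := by
    rw [← sq_abs om]; exact pow_le_pow_left₀ hE0.le hom 2
  nlinarith [sq_nonneg e]

/-- On the shell the symbol is `1/(−iω + e)`. [cite: BenfattoGiulianiMastropietro2006, §2.3] -/
theorem uvSymbolFn_eq_inv_of_klE0_le {om : ℝ} (hom : klE0 ≤ |om|) (e : ℝ) :
    uvSymbolFn 1 klE0 e om = 1 / (-I * (om : ℂ) + (e : ℂ)) := by
  unfold uvSymbolFn resolventFn
  rw [uvWeightFn_eq_one_of_klE0_le hom e]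
  push_cast
  simp

/-- Along the line through `y` in direction `e_j` the band is `c(y_{1−j}) − μ + c(y_j + t)` (as a complex number). [cite: BenfattoGiulianiMastropietro2006, §2.3] -/
theorem frameLevel_line_apply (μ : ℝ) (y : Momentum) (j : Fin 2) (t : ℝ) :
    ((frameLevel μ 0 ((2 * π) • (y + t • EuclideanSpace.single j (1 : ℝ))) : ℝ) : ℂ) =
      (((-2 * Real.cos (2 * π * y (1 - j)) - μ : ℝ) : ℂ)) + MidShell.ccl (((y j : ℝ) : ℂ) + (t : ℂ)) := by
  simp only [frameLevel, squareDispersion, TrigPolyC4v.eval_zero, sub_zero, PiLp.smul_apply, PiLp.add_apply, smul_eq_mul,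
    PiLp.single_apply, MidShell.ccl]
  fin_cases j
  · simp
    ring
  · simp
    ring

/-- **The symbol along a lattice line is the resolvent jet's `R₀`**: for `klE0 ≤ |ω|`,
`Ψ(y + t e_j) = R₀(K_j(y), y_j + t)` with `K_j(y) = −iω + (−2cos(2π y_{1−j}) − μ)`. [cite: BenfattoGiulianiMastropietro2006, §2.3] -/
theorem uvSymbol_line_eq_res0 (μ : ℝ) {om : ℝ} (hom : klE0 ≤ |om|) (y : Momentum) (j : Fin 2) (t : ℝ) :
    uvSymbolFn 1 klE0 (frameLevel μ 0 ((2 * π) • (y + t • EuclideanSpace.single j (1 : ℝ)))) om =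
      MidShell.res0 (-I * (om : ℂ) + (((-2 * Real.cos (2 * π * y (1 - j)) - μ : ℝ) : ℂ))) (((y j : ℝ) : ℂ) + (t : ℂ)) := by
  rw [uvSymbolFn_eq_inv_of_klE0_le hom, frameLevel_line_apply]
  simp only [MidShell.res0, MidShell.resD]
  ring_nf

/-- The imaginary part of the line constant `K_j(y) = −iω + (−2cos(2πy_{1−j}) − μ)` is `−ω`. [cite: BenfattoGiulianiMastropietro2006, §2.3] -/
theorem im_lineConst (μ om : ℝ) (y : Momentum) (j : Fin 2) :
    (-I * (om : ℂ) + (((-2 * Real.cos (2 * π * y (1 - j)) - μ : ℝ) : ℂ))).im = -om := by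
  rw [Complex.add_im, Complex.ofReal_im, add_zero, neg_mul, Complex.neg_im, Complex.mul_im, Complex.I_re, Complex.I_im,
    Complex.ofReal_re, Complex.ofReal_im]
  ring

/-! ## §2 The fourth directional derivatives of the symbol -/

/-- **`‖(∂_{e_j})⁴ Ψ‖ ≤ π⁴·P(|ω|)`**, `P(m) = 6144/m⁵ + 4608/m⁴ + 896/m³ + 32/m²`, for `klE0 ≤ |ω|`. [cite: BenfattoGiulianiMastropietro2006, §2.3] -/
theorem norm_dirIter_four_uvSymbol_le (μ : ℝ) {om : ℝ} (hom : klE0 ≤ |om|) (j : Fin 2) (y : Momentum) :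
    ‖LatticePeriodic.dirIter (EuclideanSpace.single j (1 : ℝ)) 4
        (fun y : Momentum => uvSymbolFn 1 klE0 (frameLevel μ 0 ((2 * π) • y)) om) y‖ ≤
      π ^ 4 * (6144 / |om| ^ 5 + 4608 / |om| ^ 4 + 896 / |om| ^ 3 + 32 / |om| ^ 2) := by
  have hE0 : (0 : ℝ) < klE0 := by norm_num [klE0]
  have hom0 : om ≠ 0 := fun h => by rw [h, abs_zero] at hom; exact absurd hom (not_le.2 hE0)
  have hg : ContDiff ℝ (⊤ : ℕ∞) (fun y : Momentum => uvSymbolFn 1 klE0 (frameLevel μ 0 ((2 * π) • y)) om) :=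
    uvSpatialSymbol_contDiff 1 (Λ := klE0) μ 0 hom0
  set K : ℂ := -I * (om : ℂ) + (((-2 * Real.cos (2 * π * y (1 - j)) - μ : ℝ) : ℂ)) with hKdef
  have hKim : K.im = -om := im_lineConst μ om y j
  have hK : K.im ≠ 0 := by rw [hKim]; exact neg_ne_zero.2 hom0
  rw [dirIter_eq_iteratedDeriv_line hg]
  have hline : (fun t : ℝ => uvSymbolFn 1 klE0 (frameLevel μ 0 ((2 * π) • (y + t • EuclideanSpace.single j (1 : ℝ)))) om) =
      fun t : ℝ => MidShell.res0 K (((y j : ℝ) : ℂ) + (t : ℂ)) := by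
    funext t; exact uvSymbol_line_eq_res0 μ hom y j t
  rw [hline, MidShell.iteratedDeriv_four_res0_real hK (y j)]
  have h := MidShell.norm_res4_real_le hK (y j + 0)
  push_cast at h
  rw [hKim, abs_neg] at h
  refine h.trans (le_of_eq ?_)
  have hm : |om| ≠ 0 := abs_ne_zero.2 hom0
  field_simp
  ring

/-- **`‖∂ⱼ⁴ (Ψ♭)‖ ≤ π⁴·P(|ω|)`** for the descended symbol on `T²`. [cite: BenfattoGiulianiMastropietro2006, §2.3] -/
theorem norm_partialDeriv_four_descend_uvSymbol_le (μ : ℝ) {om : ℝ} (hom : klE0 ≤ |om|) (j : Fin 2) (t : UnitAddTorus (Fin 2)) :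
    ‖((Torus.partialDeriv j)^[4] (Torus.descend (fun y : Momentum => uvSymbolFn 1 klE0 (frameLevel μ 0 ((2 * π) • y)) om)
        (uvSpatialSymbol_isLatticePeriodic 1 klE0 μ 0 om))) t‖ ≤
      π ^ 4 * (6144 / |om| ^ 5 + 4608 / |om| ^ 4 + 896 / |om| ^ 3 + 32 / |om| ^ 2) := by
  classical
  have hE0 : (0 : ℝ) < klE0 := by norm_num [klE0]
  have hom0 : om ≠ 0 := fun h => by rw [h, abs_zero] at hom; exact absurd hom (not_le.2 hE0)
  have hg : ContDiff ℝ (⊤ : ℕ∞) (fun y : Momentum => uvSymbolFn 1 klE0 (frameLevel μ 0 ((2 * π) • y)) om) :=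
    uvSpatialSymbol_contDiff 1 (Λ := klE0) μ 0 hom0
  obtain ⟨y, rfl⟩ := Torus.proj_surjective t
  have h := congrFun (lift_partialDeriv_iterate_descend hg (uvSpatialSymbol_isLatticePeriodic 1 klE0 μ 0 om) j 4) y
  rw [Torus.lift_apply] at h
  rw [h]
  exact norm_dirIter_four_uvSymbol_le μ hom j y

/-! ## §3 The weight inequalities of the far lattice points -/

/-- For `0 < R` and `R² ≤ a²` or `R² ≤ b²`: `a² + b² ≤ (2/R⁶)·((a²)⁴ + (b²)⁴)` and `1 ≤ ((a²)⁴ + (b²)⁴)/R⁸`. [folklore] -/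
theorem far_weight_le {a b R : ℝ} (hR : 0 < R) (h : R ^ 2 ≤ a ^ 2 ∨ R ^ 2 ≤ b ^ 2) :
    a ^ 2 + b ^ 2 ≤ 2 / R ^ 6 * ((a ^ 2) ^ 4 + (b ^ 2) ^ 4) ∧ 1 ≤ ((a ^ 2) ^ 4 + (b ^ 2) ^ 4) / R ^ 8 := by
  set M := max (a ^ 2) (b ^ 2) with hM
  have hRM : R ^ 2 ≤ M := by rcases h with h | h <;> [exact h.trans (le_max_left _ _); exact h.trans (le_max_right _ _)]
  have hM0 : 0 ≤ M := le_trans (sq_nonneg R) hRM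
  have ha : a ^ 2 ≤ M := le_max_left _ _
  have hb : b ^ 2 ≤ M := le_max_right _ _
  have hM4 : M ^ 4 ≤ (a ^ 2) ^ 4 + (b ^ 2) ^ 4 := by
    rcases le_total (a ^ 2) (b ^ 2) with hab | hab
    · rw [hM, max_eq_right hab]; nlinarith [pow_nonneg (sq_nonneg a) 4]
    · rw [hM, max_eq_left hab]; nlinarith [pow_nonneg (sq_nonneg b) 4]
  have hR6 : R ^ 6 ≤ M ^ 3 := by
    calc R ^ 6 = (R ^ 2) ^ 3 := by ring
      _ ≤ M ^ 3 := pow_le_pow_left₀ (sq_nonneg R) hRM 3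
  have hR8 : R ^ 8 ≤ M ^ 4 := by
    calc R ^ 8 = (R ^ 2) ^ 4 := by ring
      _ ≤ M ^ 4 := pow_le_pow_left₀ (sq_nonneg R) hRM 4
  have hR6pos : 0 < R ^ 6 := by positivity
  have hR8pos : 0 < R ^ 8 := by positivity
  constructor
  · rw [div_mul_eq_mul_div, le_div_iff₀ hR6pos]
    calc (a ^ 2 + b ^ 2) * R ^ 6 ≤ 2 * M * R ^ 6 := by nlinarith
      _ ≤ 2 * M * M ^ 3 := by nlinarith
      _ = 2 * M ^ 4 := by ring
      _ ≤ 2 * ((a ^ 2) ^ 4 + (b ^ 2) ^ 4) := by linarith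
  · rw [le_div_iff₀ hR8pos, one_mul]
    exact hR8.trans hM4

/-- A lattice point outside `{0} ∪ disk(Rc)` has a coordinate of absolute value `> Rc`, hence `Rc² ≤ z_j²` for some `j`. [folklore] -/
theorem sq_le_of_not_mem_insert_disk (c : SunsetCellRecordV2) {z : Site 2} (hz : z ∉ insert (0 : Site 2) c.disk) :
    ((c.Rc : ℝ)) ^ 2 ≤ ((z 0 : ℤ) : ℝ) ^ 2 ∨ ((c.Rc : ℝ)) ^ 2 ≤ ((z 1 : ℤ) : ℝ) ^ 2 := by
  rw [Finset.mem_insert, not_or, SunsetCellRecordV2.mem_disk] at hz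
  obtain ⟨hz0, hz1⟩ := hz
  have hex : ∃ j : Fin 2, (c.Rc : ℤ) < |z j| := by
    by_contra hcon
    push Not at hcon
    exact hz1 ⟨fun j => abs_le.1 (hcon j), hz0⟩
  obtain ⟨j, hj⟩ := hex
  have hj' : ((c.Rc : ℝ)) ^ 2 ≤ ((z j : ℤ) : ℝ) ^ 2 := by
    have h1 : ((c.Rc : ℝ)) ≤ |((z j : ℤ) : ℝ)| := by
      rw [← Int.cast_abs]; exact_mod_cast hj.le
    calc ((c.Rc : ℝ)) ^ 2 ≤ |((z j : ℤ) : ℝ)| ^ 2 := pow_le_pow_left₀ (Nat.cast_nonneg _) h1 2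
      _ = ((z j : ℤ) : ℝ) ^ 2 := sq_abs _
  fin_cases j
  · exact Or.inl hj'
  · exact Or.inr hj'

/-! ## §4 THE MID-SHELL FAR GAPS -/

/-- **THE MID-SHELL FAR PARSEVAL GAPS, KIT-FREE**: for `klE0 ≤ |ω|`, every `μ`, every near box `{0} ∪ disk(Rc)` with `0 < Rc`, with
`P(m) = 6144/m⁵ + 4608/m⁴ + 896/m³ + 32/m²`:
`gap₀(μ, ω) ≤ P(|ω|)²/(128·Rc⁸)` and `gap₂(μ, ω) ≤ P(|ω|)²/(64·Rc⁶)`. [cite: BenfattoGiulianiMastropietro2006, §2.3 (2.17)-(2.20)] -/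
theorem midShell_farGap_le (c : SunsetCellRecordV2) (hRc : 0 < c.Rc) (μ : ℝ) {om : ℝ} (hom : klE0 ≤ |om|) :
    ((∫ y in Torus.unitCube (Fin 2), ‖(fun y : Momentum => uvSymbolFn 1 klE0 (frameLevel μ 0 ((2 * π) • y)) om) y‖ ^ 2) -
        ∑ z ∈ insert (0 : Site 2) c.disk, ‖mFourierCoeff (Torus.descend
          (fun y : Momentum => uvSymbolFn 1 klE0 (frameLevel μ 0 ((2 * π) • y)) om) (uvSpatialSymbol_isLatticePeriodic 1 klE0 μ 0 om)) (-z)‖ ^ 2 ≤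
      (6144 / |om| ^ 5 + 4608 / |om| ^ 4 + 896 / |om| ^ 3 + 32 / |om| ^ 2) ^ 2 / (128 * (c.Rc : ℝ) ^ 8)) ∧
    ((2 * π) ^ (-(2 : ℤ)) *
        ((∫ y in Torus.unitCube (Fin 2), ‖fderiv ℝ (fun y : Momentum => uvSymbolFn 1 klE0 (frameLevel μ 0 ((2 * π) • y)) om) y (EuclideanSpace.single 0 (1 : ℝ))‖ ^ 2) +
          ∫ y in Torus.unitCube (Fin 2), ‖fderiv ℝ (fun y : Momentum => uvSymbolFn 1 klE0 (frameLevel μ 0 ((2 * π) • y)) om) y (EuclideanSpace.single 1 (1 : ℝ))‖ ^ 2) -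
        ∑ z ∈ insert (0 : Site 2) c.disk, ((((z 0 : ℤ) : ℝ)) ^ 2 + (((z 1 : ℤ) : ℝ)) ^ 2) *
          ‖mFourierCoeff (Torus.descend (fun y : Momentum => uvSymbolFn 1 klE0 (frameLevel μ 0 ((2 * π) • y)) om)
            (uvSpatialSymbol_isLatticePeriodic 1 klE0 μ 0 om)) (-z)‖ ^ 2 ≤
      (6144 / |om| ^ 5 + 4608 / |om| ^ 4 + 896 / |om| ^ 3 + 32 / |om| ^ 2) ^ 2 / (64 * (c.Rc : ℝ) ^ 6)) := by
  classical
  have hE0 : (0 : ℝ) < klE0 := by norm_num [klE0]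
  have hom0 : om ≠ 0 := fun h => by rw [h, abs_zero] at hom; exact absurd hom (not_le.2 hE0)
  set g : Momentum → ℂ := fun y : Momentum => uvSymbolFn 1 klE0 (frameLevel μ 0 ((2 * π) • y)) om with hgdef
  have hper : Torus.IsLatticePeriodic g := uvSpatialSymbol_isLatticePeriodic 1 klE0 μ 0 om
  have hg : ContDiff ℝ (⊤ : ℕ∞) g := uvSpatialSymbol_contDiff 1 (Λ := klE0) μ 0 hom0
  have hGs : Torus.IsSmooth (Torus.descend g hper) := isSmooth_descend g hper hg
  set P : ℝ := 6144 / |om| ^ 5 + 4608 / |om| ^ 4 + 896 / |om| ^ 3 + 32 / |om| ^ 2 with hPdef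
  set B : ℝ := π ^ 4 * P with hBdef
  have hB : ∀ j : Fin 2, ∀ t, ‖((Torus.partialDeriv j)^[4] (Torus.descend g hper)) t‖ ≤ B :=
    fun j t => norm_partialDeriv_four_descend_uvSymbol_le μ hom j t
  -- the two pure eighth moments
  have hT : ∀ j : Fin 2, Summable (fun k : Site 2 => (((k j : ℤ) : ℝ) ^ 2) ^ 4 * ‖mFourierCoeff (Torus.descend g hper) k‖ ^ 2) ∧
      ∑' k : Site 2, (((k j : ℤ) : ℝ) ^ 2) ^ 4 * ‖mFourierCoeff (Torus.descend g hper) k‖ ^ 2 ≤ B ^ 2 / (2 * π) ^ (2 * 4) :=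
    fun j => tsum_pow_mul_normSq_mFourierCoeff_le hGs j 4 (hB j)
  have hB2 : B ^ 2 / (2 * π) ^ (2 * 4) = P ^ 2 / 256 := by
    rw [hBdef]
    have hπ : (π : ℝ) ≠ 0 := Real.pi_ne_zero
    field_simp
    ring
  -- re-indexed by `z ↦ −z` (the kernel is `a(z) = 𝓕(g♭)(−z)`)
  set a : Site 2 → ℝ := fun z => ‖mFourierCoeff (Torus.descend g hper) (-z)‖ ^ 2 with hadef
  have hTneg : ∀ j : Fin 2, Summable (fun z : Site 2 => (((z j : ℤ) : ℝ) ^ 2) ^ 4 * a z) ∧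
      ∑' z : Site 2, (((z j : ℤ) : ℝ) ^ 2) ^ 4 * a z ≤ P ^ 2 / 256 := by
    intro j
    obtain ⟨hs, hle⟩ := hT j
    have hfun : (fun z : Site 2 => (((z j : ℤ) : ℝ) ^ 2) ^ 4 * a z) =
        (fun k : Site 2 => (((k j : ℤ) : ℝ) ^ 2) ^ 4 * ‖mFourierCoeff (Torus.descend g hper) k‖ ^ 2) ∘ (Equiv.neg (Site 2)) := by
      funext z; simp [hadef]
    have hH : HasSum (fun z : Site 2 => (((z j : ℤ) : ℝ) ^ 2) ^ 4 * a z)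
        (∑' k : Site 2, (((k j : ℤ) : ℝ) ^ 2) ^ 4 * ‖mFourierCoeff (Torus.descend g hper) k‖ ^ 2) := by
      rw [hfun]
      exact (Equiv.neg (Site 2)).hasSum_iff.2 hs.hasSum
    refine ⟨hH.summable, ?_⟩
    rw [hH.tsum_eq]
    rw [hB2] at hle
    exact hle
  have hRpos : (0 : ℝ) < (c.Rc : ℝ) := by exact_mod_cast hRc
  -- the majorant family
  set F : Site 2 → ℝ := fun z => ((((z 0 : ℤ) : ℝ) ^ 2) ^ 4 + (((z 1 : ℤ) : ℝ) ^ 2) ^ 4) * a z with hFdef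
  have hFsum : Summable F := by
    have h := (hTneg 0).1.add (hTneg 1).1
    refine h.congr fun z => ?_
    simp only [hFdef]; ring
  have hFle : ∑' z, F z ≤ P ^ 2 / 128 := by
    have h := (hTneg 0).1.hasSum.add (hTneg 1).1.hasSum
    have hF : HasSum F (∑' z : Site 2, (((z 0 : ℤ) : ℝ) ^ 2) ^ 4 * a z + ∑' z : Site 2, (((z 1 : ℤ) : ℝ) ^ 2) ^ 4 * a z) := by
      refine h.congr_fun fun z => ?_
      simp only [hFdef]; ring
    rw [hF.tsum_eq]
    linarith [(hTneg 0).2, (hTneg 1).2]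
  have hF0 : ∀ z, 0 ≤ F z := fun z => by positivity
  constructor
  · -- gap₀
    have hS0 := hasSum_normSq_kernel hper hg
    have hsum1 : Summable fun z : Site 2 => (fun _ : Site 2 => (1 : ℝ)) z * ‖mFourierCoeff (Torus.descend g hper) (-z)‖ ^ 2 := by
      simpa using hS0.summable
    have hfar := tsum_far_eq_total_sub_near hper (w := fun _ => (1 : ℝ)) (insert (0 : Site 2) c.disk) hsum1
    simp only [one_mul] at hfar
    rw [hS0.tsum_eq] at hfar
    rw [← hfar]
    -- termwise majorant
    have hle : ∀ z : Site 2, (if z ∈ insert (0 : Site 2) c.disk then (0 : ℝ) else ‖mFourierCoeff (Torus.descend g hper) (-z)‖ ^ 2) ≤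
        (1 / (c.Rc : ℝ) ^ 8) * F z := by
      intro z
      split_ifs with hz
      · exact mul_nonneg (by positivity) (hF0 z)
      · have hw := (far_weight_le hRpos (sq_le_of_not_mem_insert_disk c hz)).2
        have ha0 : 0 ≤ a z := by positivity
        calc ‖mFourierCoeff (Torus.descend g hper) (-z)‖ ^ 2 = 1 * a z := by rw [hadef]; ring
          _ ≤ (((((z 0 : ℤ) : ℝ) ^ 2) ^ 4 + (((z 1 : ℤ) : ℝ) ^ 2) ^ 4) / (c.Rc : ℝ) ^ 8) * a z :=
              mul_le_mul_of_nonneg_right hw ha0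
          _ = (1 / (c.Rc : ℝ) ^ 8) * F z := by simp only [hFdef]; ring
    have hsumL : Summable fun z : Site 2 =>
        (if z ∈ insert (0 : Site 2) c.disk then (0 : ℝ) else ‖mFourierCoeff (Torus.descend g hper) (-z)‖ ^ 2) :=
      Summable.of_nonneg_of_le (fun z => by split_ifs <;> positivity) hle ((hFsum.mul_left _))
    calc ∑' z : Site 2, (if z ∈ insert (0 : Site 2) c.disk then (0 : ℝ) else ‖mFourierCoeff (Torus.descend g hper) (-z)‖ ^ 2)
        ≤ ∑' z : Site 2, (1 / (c.Rc : ℝ) ^ 8) * F z := Summable.tsum_le_tsum hle hsumL (hFsum.mul_left _)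
      _ = (1 / (c.Rc : ℝ) ^ 8) * ∑' z, F z := tsum_mul_left
      _ ≤ (1 / (c.Rc : ℝ) ^ 8) * (P ^ 2 / 128) := mul_le_mul_of_nonneg_left hFle (by positivity)
      _ = P ^ 2 / (128 * (c.Rc : ℝ) ^ 8) := by field_simp
  · -- gap₂
    have hS2 := hasSum_sqNorm_mul_normSq_kernel hper hg
    have hfar := tsum_far_eq_total_sub_near hper (w := fun z : Site 2 => (((z 0 : ℤ) : ℝ)) ^ 2 + (((z 1 : ℤ) : ℝ)) ^ 2)
      (insert (0 : Site 2) c.disk) hS2.summable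
    rw [hS2.tsum_eq] at hfar
    rw [← hfar]
    have hle : ∀ z : Site 2, (if z ∈ insert (0 : Site 2) c.disk then (0 : ℝ) else
        ((((z 0 : ℤ) : ℝ)) ^ 2 + (((z 1 : ℤ) : ℝ)) ^ 2) * ‖mFourierCoeff (Torus.descend g hper) (-z)‖ ^ 2) ≤ (2 / (c.Rc : ℝ) ^ 6) * F z := by
      intro z
      split_ifs with hz
      · exact mul_nonneg (by positivity) (hF0 z)
      · have hw := (far_weight_le hRpos (sq_le_of_not_mem_insert_disk c hz)).1
        have ha0 : 0 ≤ a z := by positivity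
        calc ((((z 0 : ℤ) : ℝ)) ^ 2 + (((z 1 : ℤ) : ℝ)) ^ 2) * ‖mFourierCoeff (Torus.descend g hper) (-z)‖ ^ 2
            = ((((z 0 : ℤ) : ℝ)) ^ 2 + (((z 1 : ℤ) : ℝ)) ^ 2) * a z := by rw [hadef]
          _ ≤ (2 / (c.Rc : ℝ) ^ 6 * ((((z 0 : ℤ) : ℝ) ^ 2) ^ 4 + (((z 1 : ℤ) : ℝ) ^ 2) ^ 4)) * a z := mul_le_mul_of_nonneg_right hw ha0
          _ = (2 / (c.Rc : ℝ) ^ 6) * F z := by simp only [hFdef]; ring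
    have hsumL : Summable fun z : Site 2 => (if z ∈ insert (0 : Site 2) c.disk then (0 : ℝ) else
        ((((z 0 : ℤ) : ℝ)) ^ 2 + (((z 1 : ℤ) : ℝ)) ^ 2) * ‖mFourierCoeff (Torus.descend g hper) (-z)‖ ^ 2) :=
      Summable.of_nonneg_of_le (fun z => by split_ifs <;> positivity) hle ((hFsum.mul_left _))
    calc ∑' z : Site 2, (if z ∈ insert (0 : Site 2) c.disk then (0 : ℝ) else
          ((((z 0 : ℤ) : ℝ)) ^ 2 + (((z 1 : ℤ) : ℝ)) ^ 2) * ‖mFourierCoeff (Torus.descend g hper) (-z)‖ ^ 2)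
        ≤ ∑' z : Site 2, (2 / (c.Rc : ℝ) ^ 6) * F z := Summable.tsum_le_tsum hle hsumL (hFsum.mul_left _)
      _ = (2 / (c.Rc : ℝ) ^ 6) * ∑' z, F z := tsum_mul_left
      _ ≤ (2 / (c.Rc : ℝ) ^ 6) * (P ^ 2 / 128) := mul_le_mul_of_nonneg_left hFle (by positivity)
      _ = P ^ 2 / (64 * (c.Rc : ℝ) ^ 6) := by field_simp; ring


/-! ## §5 The outer-shell certificate hypothesis of the two-low-shell one-call, discharged -/

/-- For `0 < q ≤ m`: `A/mⁿ ≤ A/qⁿ` (`A ≥ 0`). [folklore] -/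
theorem div_pow_le_div_pow_of_le {A q m : ℝ} (hA : 0 ≤ A) (hq : 0 < q) (hm : q ≤ m) (n : ℕ) : A / m ^ n ≤ A / q ^ n :=
  div_le_div_of_nonneg_left hA (pow_pos hq n) (pow_le_pow_left₀ hq.le hm n)

/-- **THE OUTER-SHELL FAR-GAP CERTIFICATE FOR ANY SPLIT RADIUS AND ANY CROSSOVER `ω₀ ≥ 1/32`, PROVED** — the `hrmid` shape of
`sunsetRows_of_records3_farSup` from two closed RATIONAL inequalities on record fields (`norm_num` on literals):
`P(ω₀)²/(128·Rc⁸) ≤ rmid.G₀` and `P(ω₀)²/(64·Rc⁶) ≤ rmid.G₂`, `ω₀ = rlo.ω₁`, `P(q) = 6144/q⁵ + 4608/q⁴ + 896/q³ + 32/q²`. [cite: BenfattoGiulianiMastropietro2006, §2.3 (2.17)-(2.20)] -/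
theorem midShell_farGapCertOn_of_rat (c : SunsetCellRecordV2) (hRc : 0 < c.Rc) (rlo rmid : SunsetFarGapRecord)
    (hω₀ : (1 : ℚ) / 32 ≤ rlo.ω₁)
    (hG₀ : (6144 / rlo.ω₁ ^ 5 + 4608 / rlo.ω₁ ^ 4 + 896 / rlo.ω₁ ^ 3 + 32 / rlo.ω₁ ^ 2) ^ 2 / (128 * (c.Rc : ℚ) ^ 8) ≤ rmid.G₀)
    (hG₂ : (6144 / rlo.ω₁ ^ 5 + 4608 / rlo.ω₁ ^ 4 + 896 / rlo.ω₁ ^ 3 + 32 / rlo.ω₁ ^ 2) ^ 2 / (64 * (c.Rc : ℚ) ^ 6) ≤ rmid.G₂) :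
    ∀ μ : ℝ, (c.μlo : ℝ) ≤ μ → μ ≤ c.μhi → ∀ om : ℝ, om ≠ 0 → (rlo.ω₁ : ℝ) ≤ |om| → |om| < rmid.ω₁ →
      ((∫ y in Torus.unitCube (Fin 2), ‖(fun y : Momentum => uvSymbolFn 1 klE0 (frameLevel μ 0 ((2 * π) • y)) om) y‖ ^ 2) -
          ∑ z ∈ insert (0 : Site 2) c.disk, ‖mFourierCoeff (Torus.descend
            (fun y : Momentum => uvSymbolFn 1 klE0 (frameLevel μ 0 ((2 * π) • y)) om) (uvSpatialSymbol_isLatticePeriodic 1 klE0 μ 0 om)) (-z)‖ ^ 2 ≤ rmid.G₀) ∧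
      ((2 * π) ^ (-(2 : ℤ)) *
          ((∫ y in Torus.unitCube (Fin 2), ‖fderiv ℝ (fun y : Momentum => uvSymbolFn 1 klE0 (frameLevel μ 0 ((2 * π) • y)) om) y (EuclideanSpace.single 0 (1 : ℝ))‖ ^ 2) +
            ∫ y in Torus.unitCube (Fin 2), ‖fderiv ℝ (fun y : Momentum => uvSymbolFn 1 klE0 (frameLevel μ 0 ((2 * π) • y)) om) y (EuclideanSpace.single 1 (1 : ℝ))‖ ^ 2) -
          ∑ z ∈ insert (0 : Site 2) c.disk, ((((z 0 : ℤ) : ℝ)) ^ 2 + (((z 1 : ℤ) : ℝ)) ^ 2) *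
            ‖mFourierCoeff (Torus.descend (fun y : Momentum => uvSymbolFn 1 klE0 (frameLevel μ 0 ((2 * π) • y)) om)
              (uvSpatialSymbol_isLatticePeriodic 1 klE0 μ 0 om)) (-z)‖ ^ 2 ≤ rmid.G₂) := by
  intro μ _hμlo _hμhi om _hom0 hlo _hhi
  have hω₀r : (1 : ℝ) / 32 ≤ (rlo.ω₁ : ℝ) := by
    have h := (Rat.cast_le (K := ℝ)).2 hω₀
    push_cast at h
    exact h
  have hq0 : (0 : ℝ) < (rlo.ω₁ : ℝ) := lt_of_lt_of_le (by norm_num) hω₀r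
  have hom : klE0 ≤ |om| := by have e : klE0 = 1 / 32 := rfl; rw [e]; exact hω₀r.trans hlo
  obtain ⟨h0, h2⟩ := midShell_farGap_le c hRc μ hom
  set P : ℝ := 6144 / |om| ^ 5 + 4608 / |om| ^ 4 + 896 / |om| ^ 3 + 32 / |om| ^ 2 with hPdef
  set Q : ℝ := 6144 / (rlo.ω₁ : ℝ) ^ 5 + 4608 / (rlo.ω₁ : ℝ) ^ 4 + 896 / (rlo.ω₁ : ℝ) ^ 3 + 32 / (rlo.ω₁ : ℝ) ^ 2 with hQdef
  have hP0 : 0 ≤ P := by positivity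
  have hPQ : P ≤ Q := by
    have h5 := div_pow_le_div_pow_of_le (by norm_num : (0 : ℝ) ≤ 6144) hq0 hlo 5
    have h4 := div_pow_le_div_pow_of_le (by norm_num : (0 : ℝ) ≤ 4608) hq0 hlo 4
    have h3 := div_pow_le_div_pow_of_le (by norm_num : (0 : ℝ) ≤ 896) hq0 hlo 3
    have h2' := div_pow_le_div_pow_of_le (by norm_num : (0 : ℝ) ≤ 32) hq0 hlo 2
    linarith
  have hP2 : P ^ 2 ≤ Q ^ 2 := pow_le_pow_left₀ hP0 hPQ 2
  have hRpos : (0 : ℝ) < (c.Rc : ℝ) := by exact_mod_cast hRc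
  have hG₀r : Q ^ 2 / (128 * (c.Rc : ℝ) ^ 8) ≤ (rmid.G₀ : ℝ) := by
    have h := (Rat.cast_le (K := ℝ)).2 hG₀
    push_cast at h
    exact h
  have hG₂r : Q ^ 2 / (64 * (c.Rc : ℝ) ^ 6) ≤ (rmid.G₂ : ℝ) := by
    have h := (Rat.cast_le (K := ℝ)).2 hG₂
    push_cast at h
    exact h
  constructor
  · exact h0.trans ((div_le_div_of_nonneg_right hP2 (by positivity)).trans hG₀r)
  · exact h2.trans ((div_le_div_of_nonneg_right hP2 (by positivity)).trans hG₂r)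

end Summit.HubbardSuperconductivity.HubbardSuperconductivity.Theorems.KLRegimeSplit

end
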